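import Summits.ResolutionOfSingularities.ResolutionOfSingularities.Theorems.NoZeno.Negative.NoZenoValuativeSkeleton

/-!
# Crux `NoZeno` (stmt-ResolutionOfSingularities-16483) — the order skeleton holds along `O`
# if and only if `O` is noetherian (tightness of `noZenoSkeleton_of_isNoetherianRing`)

Route `ResolutionOfSingularities/HomologicalConductor`, crux `HomologicalConductor.NoZeno`;
negative lane (`--supports` the crux item), continuation of `NoZenoValuativeSkeleton.lean`.

`noZenoSkeleton_iff_isNoetherianRing`: for a valuation ring `O` of a field `K`, the STRONG order
skeleton of the crux (sequences of `O`-ideals `c m ∋ 0`, nested — `Persistence` —, with an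
attained minimal value, satisfying the `StrictDrop` clause verbatim with badness `1 ∉ c m`, must
reach `1 ∈ c m`) holds **iff `O` is noetherian**. The two Hahn-series witnesses of
`NoZenoValuativeSkeleton.lean` were instances; here EVERY non-noetherian valuation ring (every
`O` of rank ≥ 2, every non-discrete rank-one `O`) carries a Zeno sequence: a strictly ascending
chain of principal ideals `(z 0) < (z 1) < ⋯` (`noZeno_exists_chain_of_not_isNoetherianRing`,
from total divisibility), and `c m := (z m)`.

Reading for the birth line of the crux: its cut "noetherian `O` (stub 1) | everything else
(stubs 2–3)" is EXACTLY the boundary between what `Persistence`/`StrictDrop` yield as order data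
(stub 1 is proved from them in `Cruxes/NoZeno/Disproof.lean`) and where arithmetic of the ideals
`ca(T_m)` must enter. Kernel-only; no `def`, no named fact.
-/

set_option linter.dupNamespace false

noncomputable section

namespace Summit.ResolutionOfSingularities.ResolutionOfSingularities.Theorems.NoZeno.Negative

/-- A non-noetherian valuation ring carries a strictly ascending chain of nonzero principal
ideals `(z 0) < (z 1) < ⋯` (valuation rings are Bézout-like: divisibility is total). [folklore] -/
theorem noZeno_exists_chain_of_not_isNoetherianRing {K : Type} [Field K] (O : ValuationSubring K)
    (hO : ¬ IsNoetherianRing O) :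
    ∃ z : ℕ → O, (∀ n, z n ≠ 0) ∧ (∀ n, (z n : K) * (z (n+1) : K)⁻¹ ∈ O) ∧
      ∀ n, (z (n+1) : K) * (z n : K)⁻¹ ∉ O := by
  classical
  obtain ⟨S, hSne, hS⟩ : ∃ S : Set (Ideal O), S.Nonempty ∧ ∀ M ∈ S, ∃ I ∈ S, M < I := by
    by_contra hcon
    push Not at hcon
    apply hO
    refine set_has_maximal_iff_noetherian.mp fun S hSne => ?_
    obtain ⟨M, hM, hmax⟩ := hcon S hSne
    exact ⟨M, hM, fun I hI hlt => absurd (hmax I hI) (not_le_of_gt hlt)⟩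
  choose f hfS hflt using hS
  obtain ⟨M0, hM0⟩ := hSne
  let g : ℕ → {I : Ideal O // I ∈ S} :=
    fun n => Nat.rec ⟨M0, hM0⟩ (fun _ I => ⟨f I.1 I.2, hfS I.1 I.2⟩) n
  have hg : ∀ n, (g n).1 < (g (n+1)).1 := fun n => hflt _ (g n).2
  have hex : ∀ n, ∃ y : O, y ∈ (g (n+1)).1 ∧ y ∉ (g n).1 := fun n => SetLike.exists_of_lt (hg n)
  choose y hyin hyout using hex
  have hy0 : ∀ n, y n ≠ 0 := fun n h0 => hyout n (by rw [h0]; exact Ideal.zero_mem _)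
  refine ⟨y, hy0, fun n => ?_, fun n => ?_⟩
  · -- y n ∈ (y (n+1)) : else y (n+1) ∈ (y n) ⊆ g (n+1)
    rcases O.mem_or_inv_mem ((y n : K) * (y (n+1) : K)⁻¹) with h | h
    · exact h
    · exfalso
      rw [mul_inv_rev, inv_inv] at h
      apply hyout (n+1)
      have hy1 : (y (n+1) : K) = (⟨_, h⟩ : O) * (y n : K) := by
        show (y (n+1) : K) = (y (n+1) : K) * (y n : K)⁻¹ * (y n : K)
        rw [inv_mul_cancel_right₀ (Subtype.coe_injective.ne (hy0 n))]
      have : y (n+1) = (⟨_, h⟩ : O) * y n := Subtype.ext (by exact_mod_cast hy1)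
      rw [this]
      exact Ideal.mul_mem_left _ _ (hyin n)
  · intro h
    apply hyout (n+1)
    have hy1 : (y (n+1) : K) = (⟨_, h⟩ : O) * (y n : K) := by
      show (y (n+1) : K) = (y (n+1) : K) * (y n : K)⁻¹ * (y n : K)
      rw [inv_mul_cancel_right₀ (Subtype.coe_injective.ne (hy0 n))]
    have : y (n+1) = (⟨_, h⟩ : O) * y n := Subtype.ext (by exact_mod_cast hy1)
    rw [this]
    exact Ideal.mul_mem_left _ _ (hyin n)

/-- **The order skeleton of `NoZeno` along `O` — in its strongest form — holds IFF `O` is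
noetherian.** Strong form: the `c m` contain `0`, are `O`-ideals, are nested, have an attained
minimal value, the drop clause (badness `1 ∉ c m`), conclusion `∃ m, 1 ∈ c m`. `←` is
`noZenoSkeleton_of_isNoetherianRing`; `→`: a non-noetherian valuation ring has a strictly
ascending chain of principal ideals `(z m)`, and `c m := (z m)` is a Zeno sequence. So the cut of
line `birth` (noetherian `O` = stub 1, PROVABLE by order theory; all other `O` = stubs 2–3) is
exactly the boundary of what `Persistence`/`StrictDrop` give as order data. [folklore] -/
theorem noZenoSkeleton_iff_isNoetherianRing {K : Type} [Field K] (O : ValuationSubring K) :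
    (∀ c : ℕ → Set K,
      (∀ m, c m ⊆ O) → (∀ m, (0 : K) ∈ c m) → (∀ m, ∀ x ∈ c m, ∀ o ∈ O, o * x ∈ c m) →
      (∀ m, c m ⊆ c (m + 1)) →
      (∀ m, ∃ x ∈ c m, x ≠ 0 ∧ ∀ x' ∈ c m, x' * x⁻¹ ∈ O) →
      (∀ m, (1 : K) ∉ c m → ∃ m', m < m' ∧ ∃ y ∈ c m', y ≠ 0 ∧
        ∀ x ∈ c m, x ≠ 0 → y * x⁻¹ ∉ O) →
      ∃ m, (1 : K) ∈ c m) ↔ IsNoetherianRing O := by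
  constructor
  · intro h
    by_contra hO
    obtain ⟨z, hz0, hup, hstrict⟩ := noZeno_exists_chain_of_not_isNoetherianRing O hO
    have hz0' : ∀ n, (z n : K) ≠ 0 := fun n => Subtype.coe_injective.ne (hz0 n)
    obtain ⟨m, o, ho, hm⟩ := h (fun m => {x | ∃ o ∈ O, x = o * (z m : K)})
      (fun m => by
        rintro x ⟨o, ho, rfl⟩
        exact O.mul_mem _ _ ho (z m).2)
      (fun m => ⟨0, O.zero_mem, by rw [zero_mul]⟩)
      (fun m => by
        rintro x ⟨o, ho, rfl⟩ o' ho'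
        exact ⟨o' * o, O.mul_mem _ _ ho' ho, by rw [mul_assoc]⟩)
      (fun m => by
        rintro x ⟨o, ho, rfl⟩
        refine ⟨o * ((z m : K) * (z (m+1) : K)⁻¹), O.mul_mem _ _ ho (hup m), ?_⟩
        rw [mul_assoc, mul_assoc, inv_mul_cancel₀ (hz0' (m+1)), mul_one])
      (fun m => ⟨z m, ⟨1, O.one_mem, by rw [one_mul]⟩, hz0' m, by
        rintro x' ⟨o, ho, rfl⟩
        rwa [mul_assoc, mul_inv_cancel₀ (hz0' m), mul_one]⟩)
      (fun m _ => ⟨m + 1, Nat.lt_succ_self m, z (m+1), ⟨1, O.one_mem, by rw [one_mul]⟩,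
        hz0' (m+1), by
          rintro x ⟨o, ho, rfl⟩ hx0 hmem
          have ho0 : o ≠ 0 := by rintro rfl; exact hx0 (by rw [zero_mul])
          apply hstrict m
          have : (z (m+1) : K) * (z m : K)⁻¹ = (z (m+1) : K) * (o * (z m : K))⁻¹ * o := by
            rw [mul_inv_rev, mul_assoc, mul_assoc, inv_mul_cancel₀ ho0, mul_one]
          rw [this]
          exact O.mul_mem _ _ hmem ho⟩)
    -- 1 ∈ (z m) ⇒ z m is a unit of O ⇒ (z (m+1)) ≤ (z m): contradiction
    apply hstrict m
    have ho0 : o ≠ 0 := by rintro rfl; exact one_ne_zero (by rwa [zero_mul] at hm)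
    have hinv : (z m : K)⁻¹ = o := by
      rw [eq_comm, ← mul_eq_one_iff_eq_inv₀ (hz0' m)]; exact hm.symm
    rw [hinv]
    exact O.mul_mem _ _ (z (m+1)).2 ho
  · intro hO c h1 _ _ _ _ h6
    obtain ⟨m, hm⟩ := noZenoSkeleton_of_isNoetherianRing O hO (fun m => (1 : K) ∉ c m) c h1 h6
    exact ⟨m, not_not.mp hm⟩

end Summit.ResolutionOfSingularities.ResolutionOfSingularities.Theorems.NoZeno.Negative

end
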